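import Summits.QuantumFields.YangMills.Theorems.BalabanUVNodesN21ChartExponentCoercivityBoxSUN
import Literature.MathematicalPhysics.QuantumFieldTheory.Balaban1983to89.T4AxialGaugeFixing

/-!
# N21 (NE7c) · THE BOND DICTIONARY AT pub-balaban's AXIAL COMB, PART I: the `ℤ^d` box ∕ comb carriers of `B16Eq18Proof`
# ARE pub-balaban's torus `boxBonds lo hi` ∕ `combBonds lo hi` under `castBond (z, μ) = ⟨castSite z, μ⟩`
# (file 10a of WIDTH-209 N21 piece 2; junction of files 8–9 with `T4AxialGaugeSmallField` ∕ `T4AxialGaugeFixing`)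

Width seat pub-ymgap-dag-n21-w3 (g5), node N21 = NE7c (NOT PRINTED, NOT proved), lane K3⁸ `SpineGivenEndpointR13SepCoPHV`
(stmt-QuantumFields-27366, `--kind proof --supports … --as helper`; K3⁷ 20544 = aside ∕ lineage).  Companion of files 8–9
`…N21ChartExponentCoercivityBox` ∕ `…BoxSUN` (p635514 ∕ p636868); part II is `…N21ChartExponentCoercivityAxialComb`.

WHY.  Files 7 and 9 read the `BlockChartSU N b` ENDs' coercivity binder `h19` from print's (1.7) row THROUGH A DATUM
`e : ↥b ≃ ↥(innerBonds n y ∖ treeBonds n y)` (block bonds ↔ off-tree inner bonds of a `ℤ^d` box), certified for SOME `b`.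
The lane's measure side speaks pub-balaban's tree-gauge letters instead: the torus box `[lo, hi]` read through
`castSite : ℤ^d → T^{(j)}`, its bond set `T4AxialGaugeSmallField.boxBonds lo hi`, its AXIAL COMB
`T4AxialGaugeFixing.combBonds lo hi` (the tree `T` of `T4TreeGaugeFixing`'s gauge-fixing identity, loop-free on a
non-wrapping box by `T4TreeGaugeFixing.noClosedLoop_combBonds`; dag-n21-w2's junctions №4 ∕ №5 quantify over such `(T, U₀)`,
and dag-n21-w1 g3's `N21WindowLetterAlgebra` §1b produces №5's window letter in the COMB GAUGE for every block `b` with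
`hbox : ∀ i ∈ b, i ∈ boxBonds lo hi`, `hcomb : ∀ i ∈ b, i ∉ combBonds lo hi`).  This file IDENTIFIES the two vocabularies
under `castBond`, names THE off-comb block `b = castBond '' (innerBonds ∖ treeBonds)` (`= boxBonds lo hi ∖ combSet lo hi`),
shows it carries №5's letters `hbox` ∕ `hcomb` and is MAXIMAL among such blocks, and certifies the datum `e` of files 7 ∕ 9
for it.  Part II reads the ENDs' `h19` there with NO dictionary displayed.

WHAT (THEOREMS ONLY; 0 `def`, 0 `sorry`).  «Non-wrapping» = `hi κ − lo κ < P.sitesPerDir j` ∀ κ.  (File 9 is imported only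
to share the chart road's ambient `DecidableEq (PBond P j)` instance: the image finsets below are the consumers' terms.)
* §1 [folklore] the letters: `e_eq_unitVec` (pub-balaban's `e_μ` IS `B6BondElimination.unitVec μ`), `mem_box_sides_iff`
  (`x ∈ box n lo ↔ lo ≤ x ≤ hi`), `add_e_le_iff`, `mem_innerBonds_sides_iff` (`(z, μ)` inner ↔ `lo ≤ z ∧ z + e_μ ≤ hi`),
  `mem_treeBonds_sides_iff` (comb tree ↔ the same ∧ `lowPart μ (z − lo) = 0`), `mem_innerPlaq_sides_iff` (inner plaquette ↔
  `lo ≤ z ∧ z + e_j + e_μ ≤ hi`), `sides_le_sitesPerDir`, `sides_le_of_le`.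
* §2 [folklore] the dictionary: `castBond_injOn_innerBonds` (non-wrapping); `coe_image_castBond_innerBonds`
  (`= boxBonds lo hi`); `castPlaq_mem_boxPlaqs_iff` (plaquettes: `⟨castSite z, j, μ⟩ ∈ boxPlaqs lo hi` ↔ inner plaquette,
  non-wrapping); `image_castBond_treeBonds` (`= combBonds lo hi`); `castBond_not_mem_image_offTree_of_mem_treeBonds`;
  ★ `coe_image_castBond_offTree` (`= boxBonds lo hi ∖ combSet lo hi`); `image_castBond_offTree_eq_sdiff`; junction №5's
  block letters for the off-comb block — `mem_boxBonds_of_mem_image_offTree` (`hbox`), `not_mem_combBonds_of_mem_image_offTree`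
  (`hcomb`) — and MAXIMALITY `subset_image_offTree_of_boxBonds_of_not_combBonds`.
* §3 ★ `exists_equiv_offComb`: the datum of files 7 ∕ 9 for the NAMED block — `e : ↥(castBond '' off-tree) ≃ ↥(off-tree)`
  with `e⁻¹ = castBond` — EXISTS (non-wrapping); with pub-balaban's `T4TreeGaugeFixing.noClosedLoop_combBonds` (cited, not
  restated) the lane's loop-free `T := combBonds lo hi` and the chart's block come from ONE box.

HONEST FRAMING.  [folklore] lattice bookkeeping over pub-balaban's `castSite_injOn_box` and `noClosedLoop_combBonds` BY NAME;
no estimate; WHICH box `[lo, hi]` the lane's (M1) package fixes is dag-n21-w2 ∕ dag-n21-d's decision; nothing of Bałaban's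
asserted; (M1) ∕ NE7c NOT PRINTED ∕ NOT proved; N21 NOT discharged; K3⁸ NOT claimed; counts unmoved (typed 28∕28 · discharged
5∕27); count-neutral; one finite 𝕋⁴ at fixed ε — the Yang–Mills mass gap (Clay) is NOT proved by any of this: R4 closes the
conditional finite-𝕋⁴ rung `BalabanLadder.UV` only; nothing continuum ∕ ℝ⁴ ∕ OS.
-/

set_option autoImplicit false

noncomputable section

open Set Function Finset
namespace Summit.QuantumFields.YangMills.Theorems.N21AxialCombDictionary

open Literature.MathematicalPhysics.QuantumFieldTheory.Balaban1983to89
open Literature.MathematicalPhysics.QuantumFieldTheory.Balaban1983to89.B6BondElimination (unitVec unitVec_apply)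
open Literature.MathematicalPhysics.QuantumFieldTheory.Balaban1983to89.B16Eq18Proof
  (box mem_box treeBonds mem_treeBonds innerBonds mem_innerBonds innerPlaq treeBonds_subset_innerBonds)
open Literature.MathematicalPhysics.QuantumFieldTheory.Balaban1983to89.B7Prop1Explicit (e e_apply)
open Literature.MathematicalPhysics.QuantumFieldTheory.Balaban1983to89.B8Lemma1NonAbelian (lowPart lowPart_apply)
open Literature.MathematicalPhysics.QuantumFieldTheory.Balaban1983to89.T4AxialGaugeSmallField
  (castSite castSite_apply castSite_injOn_box boxBonds boxPlaqs)
open Literature.MathematicalPhysics.QuantumFieldTheory.Balaban1983to89.T4AxialGaugeFixing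
  (combSet combBonds mem_combBonds)

variable {P : Params} {j : ℕ}

/-! ## §1  The letters: pub-balaban's closed box `[lo, hi]` is `B16Eq18Proof.box n lo` with sides `n_κ = (hi_κ + 1 − lo_κ)⁺` -/

section Letters

variable {d : ℕ}
/-- pub-balaban's unit vector `e_μ = Pi.single μ 1` IS `B6BondElimination.unitVec μ`. [folklore] -/
theorem e_eq_unitVec (μ : Fin d) : (e μ : Fin d → ℤ) = unitVec μ := by
  funext κ
  rw [e_apply, unitVec_apply]

/-- the closed box `lo ≤ x ≤ hi` is the half-open box of `B16Eq18Proof` at corner `lo` with sides `(hi_κ + 1 − lo_κ)⁺`.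
[folklore] -/
theorem mem_box_sides_iff {lo hi x : Fin d → ℤ} :
    x ∈ box (fun κ => (hi κ + 1 - lo κ).toNat) lo ↔ lo ≤ x ∧ x ≤ hi := by
  rw [mem_box, Pi.le_def, Pi.le_def, ← forall_and]
  refine forall_congr' fun κ => ?_
  constructor
  · rintro ⟨h1, h2⟩
    refine ⟨h1, ?_⟩
    have : ((hi κ + 1 - lo κ).toNat : ℤ) ≤ max (hi κ + 1 - lo κ) 0 := by
      rw [Int.toNat_eq_max]
    omega
  · rintro ⟨h1, h2⟩
    refine ⟨h1, ?_⟩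
    have : ((hi κ + 1 - lo κ).toNat : ℤ) = hi κ + 1 - lo κ := Int.toNat_of_nonneg (by omega)
    omega

/-- `z + e_μ ≤ hi` for a box point `z` is the μ-th coordinate condition. [folklore] -/
theorem add_e_le_iff {hi z : Fin d → ℤ} (hz : z ≤ hi) (μ : Fin d) : z + e μ ≤ hi ↔ z μ + 1 ≤ hi μ := by
  rw [Pi.le_def]
  constructor
  · intro h
    have := h μ
    rw [Pi.add_apply, e_apply, if_pos rfl] at this
    exact this
  · intro h κ
    rw [Pi.add_apply, e_apply]
    split_ifs with hκ
    · subst hκ; exact h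
    · rw [add_zero]; exact hz κ

/-- the inner bonds of the box in pub-balaban's letters: `(z, μ)` is inner iff `lo ≤ z` and `z + e_μ ≤ hi`. [folklore] -/
theorem mem_innerBonds_sides_iff {lo hi : Fin d → ℤ} {bd : (Fin d → ℤ) × Fin d} :
    bd ∈ innerBonds (fun κ => (hi κ + 1 - lo κ).toNat) lo ↔ lo ≤ bd.1 ∧ bd.1 + e bd.2 ≤ hi := by
  rw [mem_innerBonds, mem_box_sides_iff]
  constructor
  · rintro ⟨⟨h1, h2⟩, h3⟩
    refine ⟨h1, (add_e_le_iff h2 bd.2).2 ?_⟩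
    have h4 : lo bd.2 ≤ bd.1 bd.2 := Pi.le_def.1 h1 bd.2
    have h5 : bd.1 bd.2 ≤ hi bd.2 := Pi.le_def.1 h2 bd.2
    have : ((hi bd.2 + 1 - lo bd.2).toNat : ℤ) = hi bd.2 + 1 - lo bd.2 := Int.toNat_of_nonneg (by omega)
    omega
  · rintro ⟨h1, h3⟩
    have h2 : bd.1 ≤ hi := by
      refine Pi.le_def.2 fun κ => ?_
      have h5 : (bd.1 + e bd.2) κ ≤ hi κ := h3 κ
      have h6 : (0 : ℤ) ≤ e bd.2 κ := by
        rw [e_apply]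
        split_ifs <;> norm_num
      rw [Pi.add_apply] at h5
      linarith
    refine ⟨⟨h1, h2⟩, ?_⟩
    have h4 := (add_e_le_iff h2 bd.2).1 h3
    have h5 : lo bd.2 ≤ bd.1 bd.2 := Pi.le_def.1 h1 bd.2
    have : ((hi bd.2 + 1 - lo bd.2).toNat : ℤ) = hi bd.2 + 1 - lo bd.2 := Int.toNat_of_nonneg (by omega)
    omega

/-- the comb tree of the box in pub-balaban's letters: inner and `lowPart μ (z − lo) = 0` (`z_κ = lo_κ`, `κ < μ`).
[folklore] -/
theorem mem_treeBonds_sides_iff {lo hi : Fin d → ℤ} {bd : (Fin d → ℤ) × Fin d} :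
    bd ∈ treeBonds (fun κ => (hi κ + 1 - lo κ).toNat) lo ↔
      (lo ≤ bd.1 ∧ bd.1 + e bd.2 ≤ hi) ∧ lowPart bd.2 (bd.1 - lo) = 0 := by
  rw [← mem_innerBonds_sides_iff, mem_innerBonds, mem_treeBonds]
  constructor
  · rintro ⟨h1, h2, h3⟩
    refine ⟨⟨h1, h3⟩, funext fun κ => ?_⟩
    rw [lowPart_apply]
    split_ifs with hκ
    · rw [Pi.sub_apply, h2 κ hκ, sub_self]; rfl
    · rfl
  · rintro ⟨⟨h1, h3⟩, h2⟩
    refine ⟨h1, fun κ hκ => ?_, h3⟩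
    have := congrFun h2 κ
    rw [lowPart_apply, if_pos hκ, Pi.sub_apply] at this
    have h0 : bd.1 κ - lo κ = 0 := this
    omega

/-- a NON-WRAPPING box has sides `≤` the torus period. [folklore] -/
theorem sides_le_sitesPerDir {lo hi : Fin P.d → ℤ} (hN : ∀ κ, hi κ - lo κ < P.sitesPerDir j) :
    ∀ κ, (hi κ + 1 - lo κ).toNat ≤ P.sitesPerDir j := fun κ => by
  have := hN κ
  omega

/-- the (1.8) side clause in the box letters: `hi_κ + 1 − lo_κ ≤ 100M` ⇒ sides `≤ 100M`. [folklore] -/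
theorem sides_le_of_le {lo hi : Fin d → ℤ} {M : ℕ} (hM : ∀ κ, hi κ + 1 - lo κ ≤ 100 * M) :
    ∀ κ, (hi κ + 1 - lo κ).toNat ≤ 100 * M := fun κ => by
  have := hM κ
  omega

/-- the inner PLAQUETTES of the box in pub-balaban's letters: `(z, j, μ)` (`j < μ`) is an inner plaquette iff `lo ≤ z`
and `z + e_j + e_μ ≤ hi` (all four corners in the closed box). [folklore] -/
theorem mem_innerPlaq_sides_iff {lo hi z : Fin d → ℤ} {i μ : Fin d} (hiμ : i < μ) :
    (z, i, μ) ∈ innerPlaq (fun κ => (hi κ + 1 - lo κ).toNat) lo ↔ lo ≤ z ∧ z + e i + e μ ≤ hi := by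
  rw [B16Eq18Proof.mem_innerPlaq, mem_box_sides_iff]
  constructor
  · rintro ⟨⟨h1, h2⟩, -, h3, h4⟩
    dsimp only at h3 h4
    refine ⟨h1, Pi.le_def.2 fun κ => ?_⟩
    have h5 : lo κ ≤ z κ := Pi.le_def.1 h1 κ
    have h6 : z κ ≤ hi κ := Pi.le_def.1 h2 κ
    have h7 : ((hi i + 1 - lo i).toNat : ℤ) = hi i + 1 - lo i :=
      Int.toNat_of_nonneg (by have := Pi.le_def.1 h1 i; have := Pi.le_def.1 h2 i; omega)
    have h8 : ((hi μ + 1 - lo μ).toNat : ℤ) = hi μ + 1 - lo μ :=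
      Int.toNat_of_nonneg (by have := Pi.le_def.1 h1 μ; have := Pi.le_def.1 h2 μ; omega)
    simp only [Pi.add_apply, e_apply]
    by_cases hκi : κ = i
    · subst hκi
      rw [if_pos rfl, if_neg (ne_of_lt hiμ)]
      omega
    · by_cases hκμ : κ = μ
      · subst hκμ
        rw [if_neg hκi, if_pos rfl]
        omega
      · rw [if_neg hκi, if_neg hκμ]
        omega
  · rintro ⟨h1, h3⟩
    have hκ : ∀ κ, z κ + e i κ + e μ κ ≤ hi κ := fun κ => by
      have := Pi.le_def.1 h3 κ
      simpa only [Pi.add_apply] using this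
    have h2 : z ≤ hi := Pi.le_def.2 fun κ => by
      have h5 := hκ κ
      have h6 : (0 : ℤ) ≤ e i κ := by rw [e_apply]; split_ifs <;> norm_num
      have h7 : (0 : ℤ) ≤ e μ κ := by rw [e_apply]; split_ifs <;> norm_num
      linarith
    have hi' := hκ i
    have hμ' := hκ μ
    rw [e_apply, if_pos rfl, e_apply, if_neg (ne_of_lt hiμ)] at hi'
    rw [e_apply, if_neg (ne_of_gt hiμ), e_apply, if_pos rfl] at hμ'
    have h7 : ((hi i + 1 - lo i).toNat : ℤ) = hi i + 1 - lo i :=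
      Int.toNat_of_nonneg (by have := Pi.le_def.1 h1 i; omega)
    have h8 : ((hi μ + 1 - lo μ).toNat : ℤ) = hi μ + 1 - lo μ :=
      Int.toNat_of_nonneg (by have := Pi.le_def.1 h1 μ; omega)
    exact ⟨⟨h1, h2⟩, hiμ, by dsimp only; omega, by dsimp only; omega⟩

end Letters

/-! ## §2  The bond dictionary `castBond (z, μ) = ⟨castSite z, μ⟩` on the box: inner bonds ↦ `boxBonds`, comb ↦ `combBonds` -/

section Dictionary

variable {lo hi : Fin P.d → ℤ}

/-- `castBond` is INJECTIVE on the inner bonds of a non-wrapping box (pub-balaban's `castSite_injOn_box` on the sources,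
directions untouched). [folklore] -/
theorem castBond_injOn_innerBonds (hN : ∀ κ, hi κ - lo κ < P.sitesPerDir j) :
    Set.InjOn (fun bd : (Fin P.d → ℤ) × Fin P.d => (⟨castSite bd.1, bd.2⟩ : PBond P j))
      ↑(innerBonds (fun κ => (hi κ + 1 - lo κ).toNat) lo) := by
  intro bd hbd bd' hbd' h
  have h1 := (mem_box_sides_iff (d := P.d)).1 (mem_innerBonds.1 (Finset.mem_coe.1 hbd)).1
  have h2 := (mem_box_sides_iff (d := P.d)).1 (mem_innerBonds.1 (Finset.mem_coe.1 hbd')).1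
  have hsrc : (castSite bd.1 : Site P j) = castSite bd'.1 := congrArg PBond.src h
  have hdir : bd.2 = bd'.2 := congrArg PBond.dir h
  exact Prod.ext (castSite_injOn_box hN h1.1 h1.2 h2.1 h2.2 hsrc) hdir

/-- the image of the INNER BONDS of the box is pub-balaban's `boxBonds lo hi`. [folklore] -/
theorem coe_image_castBond_innerBonds :
    (((innerBonds (fun κ => (hi κ + 1 - lo κ).toNat) lo).image
        fun bd : (Fin P.d → ℤ) × Fin P.d => (⟨castSite bd.1, bd.2⟩ : PBond P j)) : Set (PBond P j)) =
      boxBonds lo hi := by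
  ext b
  rw [Finset.coe_image, Set.mem_image]
  constructor
  · rintro ⟨bd, hbd, rfl⟩
    obtain ⟨h1, h2⟩ := mem_innerBonds_sides_iff.1 (Finset.mem_coe.1 hbd)
    exact ⟨bd.1, h1, h2, rfl⟩
  · rintro ⟨x, h1, h2, h3⟩
    refine ⟨(x, b.dir), Finset.mem_coe.2 (mem_innerBonds_sides_iff.2 ⟨h1, h2⟩), ?_⟩
    cases b
    simp only at h3 ⊢
    rw [h3]

/-- the PLAQUETTE DICTIONARY: on a non-wrapping box, the torus plaquette `⟨castSite z, j, μ⟩` (`j < μ`) lies in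
pub-balaban's `boxPlaqs lo hi` iff `(z, j, μ)` is an inner plaquette of the `ℤ^d` box (for `z` in the closed box). [folklore] -/
theorem castPlaq_mem_boxPlaqs_iff (hN : ∀ κ, hi κ - lo κ < P.sitesPerDir j) {z : Fin P.d → ℤ} (hz : lo ≤ z ∧ z ≤ hi)
    {i μ : Fin P.d} (hiμ : i < μ) :
    (⟨castSite z, i, μ, hiμ⟩ : Plaq P j) ∈ (boxPlaqs lo hi : Set (Plaq P j)) ↔
      (z, i, μ) ∈ innerPlaq (fun κ => (hi κ + 1 - lo κ).toNat) lo := by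
  rw [mem_innerPlaq_sides_iff hiμ]
  constructor
  · rintro ⟨x, h1, h2, h3⟩
    have hx' : x ≤ hi := Pi.le_def.2 fun κ => by
      have h5 := Pi.le_def.1 h2 κ
      simp only [Pi.add_apply] at h5
      have h6 : (0 : ℤ) ≤ e i κ := by rw [e_apply]; split_ifs <;> norm_num
      have h7 : (0 : ℤ) ≤ e μ κ := by rw [e_apply]; split_ifs <;> norm_num
      linarith
    have hzx : z = x := castSite_injOn_box hN hz.1 hz.2 h1 hx' h3
    subst hzx
    exact ⟨h1, h2⟩
  · rintro ⟨h1, h2⟩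
    exact ⟨z, h1, h2, rfl⟩

/-- the image of the COMB TREE of the box is pub-balaban's `combBonds lo hi`. [folklore] -/
theorem image_castBond_treeBonds :
    (treeBonds (fun κ => (hi κ + 1 - lo κ).toNat) lo).image
        (fun bd : (Fin P.d → ℤ) × Fin P.d => (⟨castSite bd.1, bd.2⟩ : PBond P j)) = combBonds lo hi := by
  ext b
  rw [Finset.mem_image, mem_combBonds]
  constructor
  · rintro ⟨bd, hbd, rfl⟩
    obtain ⟨⟨h1, h2⟩, h3⟩ := mem_treeBonds_sides_iff.1 hbd
    exact ⟨bd.1, h1, h2, rfl, h3⟩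
  · rintro ⟨x, h1, h2, h3, h4⟩
    refine ⟨(x, b.dir), mem_treeBonds_sides_iff.2 ⟨⟨h1, h2⟩, h4⟩, ?_⟩
    cases b
    simp only at h3 ⊢
    rw [h3]

/-- the image of a TREE bond is not the image of an OFF-TREE inner bond (non-wrapping box). [folklore] -/
theorem castBond_not_mem_image_offTree_of_mem_treeBonds (hN : ∀ κ, hi κ - lo κ < P.sitesPerDir j)
    {bd : (Fin P.d → ℤ) × Fin P.d} (hbd : bd ∈ treeBonds (fun κ => (hi κ + 1 - lo κ).toNat) lo) :
    (⟨castSite bd.1, bd.2⟩ : PBond P j) ∉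
      (innerBonds (fun κ => (hi κ + 1 - lo κ).toNat) lo \ treeBonds (fun κ => (hi κ + 1 - lo κ).toNat) lo).image
        fun bd' : (Fin P.d → ℤ) × Fin P.d => (⟨castSite bd'.1, bd'.2⟩ : PBond P j) := by
  intro h
  obtain ⟨bd', hbd', hEq⟩ := Finset.mem_image.1 h
  have h1 : bd' ∈ innerBonds (fun κ => (hi κ + 1 - lo κ).toNat) lo := (mem_sdiff.1 hbd').1
  have h2 : bd ∈ innerBonds (fun κ => (hi κ + 1 - lo κ).toNat) lo := treeBonds_subset_innerBonds lo hbd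
  have := castBond_injOn_innerBonds hN (Finset.mem_coe.2 h1) (Finset.mem_coe.2 h2) hEq
  exact (mem_sdiff.1 hbd').2 (this ▸ hbd)

/-- ★ the image of the OFF-TREE inner bonds of the box is pub-balaban's box bond set MINUS ITS AXIAL COMB:
`castBond '' (innerBonds ∖ treeBonds) = boxBonds lo hi ∖ combSet lo hi` (non-wrapping box). [folklore] -/
theorem coe_image_castBond_offTree (hN : ∀ κ, hi κ - lo κ < P.sitesPerDir j) :
    (((innerBonds (fun κ => (hi κ + 1 - lo κ).toNat) lo \ treeBonds (fun κ => (hi κ + 1 - lo κ).toNat) lo).image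
        fun bd : (Fin P.d → ℤ) × Fin P.d => (⟨castSite bd.1, bd.2⟩ : PBond P j)) : Set (PBond P j)) =
      boxBonds lo hi \ combSet lo hi := by
  ext b
  rw [Finset.coe_image, Set.mem_image, Set.mem_sdiff, ← coe_image_castBond_innerBonds (lo := lo) (hi := hi),
    Finset.coe_image, Set.mem_image, ← mem_combBonds, ← image_castBond_treeBonds (lo := lo) (hi := hi), Finset.mem_image]
  constructor
  · rintro ⟨bd, hbd, rfl⟩
    obtain ⟨h1, h2⟩ := mem_sdiff.1 (Finset.mem_coe.1 hbd)
    refine ⟨⟨bd, Finset.mem_coe.2 h1, rfl⟩, ?_⟩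
    rintro ⟨bd', hbd', hEq⟩
    have := castBond_injOn_innerBonds hN (Finset.mem_coe.2 (treeBonds_subset_innerBonds lo hbd'))
      (Finset.mem_coe.2 h1) hEq
    exact h2 (this ▸ hbd')
  · rintro ⟨⟨bd, hbd, rfl⟩, hnot⟩
    refine ⟨bd, Finset.mem_coe.2 (mem_sdiff.2 ⟨Finset.mem_coe.1 hbd, fun ht => hnot ⟨bd, ht, rfl⟩⟩), rfl⟩

/-- the comb is part of the image of the inner bonds, and DISJOINT from the image of the off-tree ones: as finsets,
`castBond '' (innerBonds ∖ treeBonds) = castBond '' innerBonds ∖ combBonds lo hi`. [folklore] -/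
theorem image_castBond_offTree_eq_sdiff (hN : ∀ κ, hi κ - lo κ < P.sitesPerDir j) :
    (innerBonds (fun κ => (hi κ + 1 - lo κ).toNat) lo \ treeBonds (fun κ => (hi κ + 1 - lo κ).toNat) lo).image
        (fun bd : (Fin P.d → ℤ) × Fin P.d => (⟨castSite bd.1, bd.2⟩ : PBond P j)) =
      (innerBonds (fun κ => (hi κ + 1 - lo κ).toNat) lo).image
          (fun bd : (Fin P.d → ℤ) × Fin P.d => (⟨castSite bd.1, bd.2⟩ : PBond P j)) \ combBonds lo hi := by
  classical
  rw [← image_castBond_treeBonds (lo := lo) (hi := hi)]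
  exact Finset.image_sdiff_of_injOn (castBond_injOn_innerBonds hN) (treeBonds_subset_innerBonds lo)

/-- junction №5's first block letter (dag-n21-w1 g3 `N21WindowLetterAlgebra.pi_withDensity_fixTo_comb_eq_blockLaw_window_mul`,
`hbox : ∀ i ∈ b, i ∈ boxBonds lo hi`) HOLDS for the off-comb block `b = castBond '' (innerBonds ∖ treeBonds)`. [folklore] -/
theorem mem_boxBonds_of_mem_image_offTree {i : PBond P j}
    (hi' : i ∈ (innerBonds (fun κ => (hi κ + 1 - lo κ).toNat) lo \ treeBonds (fun κ => (hi κ + 1 - lo κ).toNat) lo).image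
        fun bd : (Fin P.d → ℤ) × Fin P.d => (⟨castSite bd.1, bd.2⟩ : PBond P j)) :
    i ∈ (boxBonds lo hi : Set (PBond P j)) := by
  rw [← coe_image_castBond_innerBonds (lo := lo) (hi := hi), Finset.coe_image]
  obtain ⟨bd, hbd, rfl⟩ := Finset.mem_image.1 hi'
  exact ⟨bd, Finset.mem_coe.2 (mem_sdiff.1 hbd).1, rfl⟩

/-- junction №5's second block letter (`hcomb : ∀ i ∈ b, i ∉ combBonds lo hi`) HOLDS for the off-comb block of a
non-wrapping box. [folklore] -/
theorem not_mem_combBonds_of_mem_image_offTree (hN : ∀ κ, hi κ - lo κ < P.sitesPerDir j) {i : PBond P j}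
    (hi' : i ∈ (innerBonds (fun κ => (hi κ + 1 - lo κ).toNat) lo \ treeBonds (fun κ => (hi κ + 1 - lo κ).toNat) lo).image
        fun bd : (Fin P.d → ℤ) × Fin P.d => (⟨castSite bd.1, bd.2⟩ : PBond P j)) :
    i ∉ (combBonds lo hi : Finset (PBond P j)) := by
  have h : i ∈ (boxBonds lo hi : Set (PBond P j)) \ combSet lo hi := by
    rw [← coe_image_castBond_offTree hN]
    exact Finset.mem_coe.2 hi'
  rw [mem_combBonds]
  exact h.2

/-- MAXIMALITY: every block `b` of box bonds off the comb (junction №5's letters `hbox`, `hcomb`) is contained in the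
off-comb block `castBond '' (innerBonds ∖ treeBonds)` (non-wrapping box). [folklore] -/
theorem subset_image_offTree_of_boxBonds_of_not_combBonds (hN : ∀ κ, hi κ - lo κ < P.sitesPerDir j)
    (b : Finset (PBond P j)) (hbox : ∀ i ∈ b, i ∈ (boxBonds lo hi : Set (PBond P j)))
    (hcomb : ∀ i ∈ b, i ∉ (combBonds lo hi : Finset (PBond P j))) :
    b ⊆ (innerBonds (fun κ => (hi κ + 1 - lo κ).toNat) lo \ treeBonds (fun κ => (hi κ + 1 - lo κ).toNat) lo).image
        fun bd : (Fin P.d → ℤ) × Fin P.d => (⟨castSite bd.1, bd.2⟩ : PBond P j) := by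
  intro i hib
  have h : i ∈ (boxBonds lo hi : Set (PBond P j)) \ combSet lo hi :=
    ⟨hbox i hib, fun hc => hcomb i hib (mem_combBonds.2 hc)⟩
  rw [← coe_image_castBond_offTree hN] at h
  exact Finset.mem_coe.1 h

end Dictionary

/-! ## §3  ★ The datum of files 7 ∕ 9 EXISTS for the named block; the comb is loop-free (pub-balaban) -/

section Datum

variable {lo hi : Fin P.d → ℤ}

/-- ★ **THE DICTIONARY FOR THE OFF-COMB BLOCK EXISTS**: on a non-wrapping box, the block
`b = castBond '' (innerBonds ∖ treeBonds)` of torus bonds is in bijection `e` with the off-tree inner bonds of the `ℤ^d` box,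
and `e⁻¹` IS `castBond` (no junk bijection) — the datum `e` of `N21ChartExponentCoercivitySUN.ineq19_blockChartSU_of_ineq17`
∕ `…BoxSUN.ineq19_blockChartSU_of_ineq17_box` at the NAMED block; the comb itself is loop-free by pub-balaban's
`T4TreeGaugeFixing.noClosedLoop_combBonds hN` (the lane's `T`-letter). [folklore] -/
theorem exists_equiv_offComb (hN : ∀ κ, hi κ - lo κ < P.sitesPerDir j) :
    ∃ e : ↥((innerBonds (fun κ => (hi κ + 1 - lo κ).toNat) lo \ treeBonds (fun κ => (hi κ + 1 - lo κ).toNat) lo).image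
          fun bd : (Fin P.d → ℤ) × Fin P.d => (⟨castSite bd.1, bd.2⟩ : PBond P j)) ≃
        ↥(innerBonds (fun κ => (hi κ + 1 - lo κ).toNat) lo \ treeBonds (fun κ => (hi κ + 1 - lo κ).toNat) lo),
      ∀ s, (↑(e.symm s) : PBond P j) = ⟨castSite (s : (Fin P.d → ℤ) × Fin P.d).1, (s : (Fin P.d → ℤ) × Fin P.d).2⟩ := by
  classical
  set S := innerBonds (fun κ => (hi κ + 1 - lo κ).toNat) lo \ treeBonds (fun κ => (hi κ + 1 - lo κ).toNat) lo with hS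
  set f : (Fin P.d → ℤ) × Fin P.d → PBond P j := fun bd => ⟨castSite bd.1, bd.2⟩ with hf
  have hinj : Set.InjOn f (S : Set ((Fin P.d → ℤ) × Fin P.d)) :=
    (castBond_injOn_innerBonds hN).mono (Finset.coe_subset.2 Finset.sdiff_subset)
  have hbij : Set.BijOn f (S : Set ((Fin P.d → ℤ) × Fin P.d)) ((S.image f : Finset (PBond P j)) : Set (PBond P j)) := by
    rw [Finset.coe_image]
    exact hinj.bijOn_image
  refine ⟨(hbij.equiv f).symm, fun s => ?_⟩
  rw [Equiv.symm_symm]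
  rfl

end Datum

end Summit.QuantumFields.YangMills.Theorems.N21AxialCombDictionary

end
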